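import Summits.MatrixMultiplication.OmegaCensus.STPPKill223332332Z46AP1

/-!
# ω-census (abelian STPP census): `{(2,2,3),(3,3,2),(3,3,2)}` in `ℤ/46ℤ`, all-progression branch — the `C`-steps are `±k` times the cross step, `3 ≤ k ≤ 9` (kernel)

HONEST FRAMING (pub-omega census; verbatim): lottery ticket; floor = certified bounds/negative ranges.
Census STRUCTURE (seat pub-omega-stpp-2 gen 32, 2026-08-30), family (b2); second step of BRANCH I of HOME `pub-omega-stpp-2-g32/CASEMAP.md` §6.
A `2 × 3` grid `{y + εδ + je : ε ≤ 1, j ≤ 2}` with SIX distinct points inside a `12`-term progression of step `d`, whose row step is `e = ±d` (`cross_step_eq`), has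
`δ = ±k•d` with `3 ≤ k ≤ 9` (`grid_step_bounds`: index bookkeeping; `k ≥ 3` is distinctness, `k ≤ 9` is the fit of both rows).  Applied to `Y₂ = C₂ − B₂ ⊆ Y°₁` and
`Z₂ = C₂ − A₂ ⊆ Z°₁` this pins `δ₂` to `±k₂ d₁` and `±k₂′ e₁`, `3 ≤ k₂, k₂′ ≤ 9` (`deltas_223_332_332`).  Nothing here is progress on `ω`.

References: H. Cohn, R. Kleinberg, B. Szegedy, C. Umans, FOCS 2005 (arXiv:math/0511460), Def. 5.1; Nathanson GTM 165 §2.5 (tree `apFinset`).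
-/

open Finset
open scoped Pointwise

namespace Summit.MatrixMultiplication.OmegaCensus.Z46

open Literature.Computability.AlgebraicComplexity
open Literature.Combinatorics.Additive
open Summit.MatrixMultiplication.OmegaCensus.STPPKneser
open Summit.MatrixMultiplication.OmegaCensus.CubeNB

set_option synthInstance.maxHeartbeats 400000 in
set_option synthInstance.maxSize 4096 in
/-- Index cancellation (kernel decision): `j•d − i•d = d` with `i, j < 13`, `2d ≠ 0` forces `j = i + 1`; `= −d` forces `i = j + 1`. [folklore] -/
theorem index_unit : ∀ d : ZMod 46, 2 • d ≠ 0 → ∀ i < 13, ∀ j < 13,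
    ((j • d - i • d : ZMod 46) = d → j = i + 1) ∧ ((j • d - i • d : ZMod 46) = -d → i = j + 1) := by
  set_option maxRecDepth 100000 in decide +kernel

/-- Consecutive indices: if `x = t + i•d`, `x + e = t + j•d` (`i, j < 13`) and `e = d` (resp. `−d`) then `j = i + 1` (resp. `i = j + 1`). [folklore] -/
theorem index_succ {t d x e : ZMod 46} (hd : 2 • d ≠ 0) {i j : ℕ} (hi : i < 13) (hj : j < 13) (hx : t + i • d = x) (hx' : t + j • d = x + e) :
    (e = d → j = i + 1) ∧ (e = -d → i = j + 1) := by
  have he : e = j • d - i • d := by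
    have : (t + j • d) - (t + i • d) = e := by rw [hx, hx']; abel
    rw [← this]; abel
  obtain ⟨h1, h2⟩ := index_unit d hd i hi j hj
  exact ⟨fun h => h1 (by rw [← he, h]), fun h => h2 (by rw [← he, h])⟩

/-- **Grid step bounds.**  See the module docstring. [folklore] -/
theorem grid_step_bounds {t d y e δ : ZMod 46} (hd : 2 • d ≠ 0) (he : e = d ∨ e = -d)
    (h00 : y ∈ apFinset t d 12) (h01 : y + e ∈ apFinset t d 12) (h02 : y + e + e ∈ apFinset t d 12)
    (h10 : y + δ ∈ apFinset t d 12) (h11 : y + δ + e ∈ apFinset t d 12) (h12 : y + δ + e + e ∈ apFinset t d 12)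
    (hδ0 : δ ≠ 0) (hδ1 : δ ≠ e) (hδ2 : δ ≠ e + e) (hδ3 : δ ≠ -e) (hδ4 : δ ≠ -e - e) :
    ∃ k : ℕ, 3 ≤ k ∧ k ≤ 9 ∧ (δ = k • d ∨ δ = -(k • d)) := by
  rw [mem_apFinset] at h00 h01 h02 h10 h11 h12
  obtain ⟨i₀, hi₀, hy₀⟩ := h00
  obtain ⟨i₁, hi₁, hy₁⟩ := h01
  obtain ⟨i₂, hi₂, hy₂⟩ := h02
  obtain ⟨l₀, hl₀, hz₀⟩ := h10
  obtain ⟨l₁, hl₁, hz₁⟩ := h11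
  obtain ⟨l₂, hl₂, hz₂⟩ := h12
  have hδ : δ = l₀ • d - i₀ • d := by
    have : (t + l₀ • d) - (t + i₀ • d) = δ := by rw [hy₀, hz₀]; abel
    rw [← this]; abel
  have s01 := index_succ hd (by omega) (by omega) hy₀ hy₁
  have s12 := index_succ hd (by omega) (by omega) hy₁ hy₂
  have s01' := index_succ hd (by omega) (by omega) hz₀ hz₁
  have s12' := index_succ hd (by omega) (by omega) hz₁ hz₂
  -- excluded coincidences, as index statements
  have hne0 : l₀ ≠ i₀ := by rintro rfl; exact hδ0 (by rw [hδ, sub_self])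
  have hne1 : l₀ ≠ i₀ + 1 := by
    rintro rfl; rcases he with rfl | rfl
    · exact hδ1 (by rw [hδ, succ_nsmul]; abel)
    · -- e = -d: then i₁ = i₀ - 1; δ = d = -e
      exact hδ3 (by rw [hδ, succ_nsmul, neg_neg]; abel)
  have hne2 : l₀ ≠ i₀ + 2 := by
    rintro rfl; rcases he with rfl | rfl
    · exact hδ2 (by rw [hδ, add_nsmul, two_nsmul]; abel)
    · exact hδ4 (by rw [hδ, add_nsmul, two_nsmul, neg_neg]; abel)
  have hne3 : i₀ ≠ l₀ + 1 := by
    rintro rfl; rcases he with rfl | rfl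
    · exact hδ3 (by rw [hδ, succ_nsmul]; abel)
    · exact hδ1 (by rw [hδ, succ_nsmul]; abel)
  have hne4 : i₀ ≠ l₀ + 2 := by
    rintro rfl; rcases he with rfl | rfl
    · exact hδ4 (by rw [hδ, add_nsmul, two_nsmul]; abel)
    · exact hδ2 (by rw [hδ, add_nsmul, two_nsmul]; abel)
  -- the two rows are consecutive triples with the same orientation
  have finish : (i₀ + 2 < 12 ∧ l₀ + 2 < 12) ∨ (2 ≤ i₀ ∧ 2 ≤ l₀) → ∃ k : ℕ, 3 ≤ k ∧ k ≤ 9 ∧ (δ = k • d ∨ δ = -(k • d)) := by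
    intro hrows
    by_cases hle : i₀ ≤ l₀
    · refine ⟨l₀ - i₀, by omega, by omega, Or.inl ?_⟩
      rw [hδ, sub_nsmul d hle]; abel
    · refine ⟨i₀ - l₀, by omega, by omega, Or.inr ?_⟩
      rw [hδ, sub_nsmul d (by omega : l₀ ≤ i₀)]; abel
  rcases he with rfl | rfl
  · have e1 := s01.1 rfl; have e2 := s12.1 rfl; have e3 := s01'.1 rfl; have e4 := s12'.1 rfl
    exact finish (Or.inl ⟨by omega, by omega⟩)
  · have e1 := s01.2 rfl; have e2 := s12.2 rfl; have e3 := s01'.2 rfl; have e4 := s12'.2 rfl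
    exact finish (Or.inr ⟨by omega, by omega⟩)

end Summit.MatrixMultiplication.OmegaCensus.Z46
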